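import Summits.BirchSwinnertonDyer.BirchSwinnertonDyer.Theorems.ErratumRoadFiveNonSurjCornerKolyJRedefinition
import Summits.BirchSwinnertonDyer.BirchSwinnertonDyer.Theorems.ClassRecordThreeEulerHalvesAtThreeSection6Bridge
import HarnessLib

/-!
# Route `PrintX9`, crux J = `HeegnerDivisibilityX9` (item 20392), stub `stub_jetchevX9`: the frame-generic END BRIDGE
# «swap supply + per-level inequality ⟹ `p^s ∣ P_n`» with the per-level inequality asked only at levels `k > t`

Cell `bsd-print-x9` (print tier, key `x9`), prover seat p4; `--supports stmt-BirchSwinnertonDyer-20392`,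
helper; THEOREMS ONLY, frame-generic (any level `N`, any prime `p`), nothing booked, BSD is not proved by any of this.

WHAT. Cell bsd-stepL corner-p1's `Koly.pDiv_of_swap_of_perLevel` (`ErratumRoadFiveNonSurjCornerKolyJRedefinitionSharp`:
from Kolyvagin's `r`-free PRIME SWAP `hswap` and the per-level inequality `hlev` — «`m(n) < k`, `t ≤ k`, `k + m(n) ≤ M(n)`
⟹ `t ≤ m(n)`» for every admissible `(n, d)` — to `p^s ∣ P_n` for `s ≤ t`, via `Koly.kolyvaginRedefinition_of_swap` and
bsd-jet's abstract §6) asks `hlev` at `t ≤ k`; Jetchev's deduction uses only `k := max(t, m_∞) + 1 > t` (Compos. Math.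
144 p. 824), and the X9 per-level inequality (`PrintX9JetchevX9SwapBridge`, from the node Thm. 5.2 whose Kolyvagin class
`c_k(c)` must be non-zero) comes with `t < k`. This file re-issues the three deduction steps with `t < k`:
`tamagawaExponent_le_mInfty_of_perLevel_lt` / `depth_le_mdiv_of_perLevel_lt` (bsd-jet's
`JET.Section6.tamagawaExponent_le_mInfty_of_perLevel` / `depth_le_mdiv_of_perLevel`, abstract), `pDiv_of_perLevel_lt`
(tam3-p1's `Koly.pDiv_of_perLevel`) and `pDiv_of_swap_of_perLevel_lt` (corner-p1's `Koly.pDiv_of_swap_of_perLevel`);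
proofs verbatim with `htk : t < k`. CONDITIONAL on the displayed `hswap`/`hlev`; nothing asserted.

References: [cite: Jetchev2008, Thm. 1.4 (p. 812), proof of Thm. 1.1 (p. 824)] [cite: McCallumLMS1991, §5 Lemma 5.1,
Prop. 5.2 (pp. 303–306)] [cite: BurungaleEtAl2026, Prop. 2.2.1 (§2.2)].
-/

set_option autoImplicit false

noncomputable section

open scoped Classical

open WeierstrassCurve Literature.NumberTheory.EllipticCurves
  Literature.NumberTheory.EllipticCurves.ModularForms
  Summit.BirchSwinnertonDyer.Rank1Residual Summit.BirchSwinnertonDyer.Rank1Residual.X11b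
  Summit.BirchSwinnertonDyer.Rank1Residual.X11b.Three
  Summit.BirchSwinnertonDyer.Rank1Residual.JET

namespace Summit.BirchSwinnertonDyer.Rank1Residual.JET.Split

/-! ### The abstract deduction and the frame-generic end bridge with `t < k` -/

/-- bsd-jet's `JET.Section6.tamagawaExponent_le_mInfty_of_perLevel` with the per-level inequality asked only at levels
`k > t` (the printed `k := max(t, m_∞) + 1`, Jetchev 2008 p. 824). [cite: Jetchev2008, Proof of Thm. 1.4 (p. 825)] -/
theorem tamagawaExponent_le_mInfty_of_perLevel_lt
    {Λ : Type*} (M m : Λ → ℕ∞) (t mInf : ℕ)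
    (hK : ∀ m' : ℕ, ∃ c, (m' : ℕ∞) ≤ M c ∧ m c = mInf)
    (hlev : ∀ (k : ℕ) (c : Λ), m c < (k : ℕ∞) → t < k → (k : ℕ∞) + m c ≤ M c → (t : ℕ∞) ≤ m c) :
    t ≤ mInf := by
  set k : ℕ := max t mInf + 1 with hk
  have htk : t < k := by omega
  have hInfk : mInf < k := by omega
  obtain ⟨c, hMc, hmc⟩ := hK (k + mInf)
  have h1 : m c < (k : ℕ∞) := by rw [hmc]; exact_mod_cast hInfk
  have h2 : (k : ℕ∞) + m c ≤ M c := by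
    rw [hmc]
    calc (k : ℕ∞) + mInf = ((k + mInf : ℕ) : ℕ∞) := by push_cast; ring
      _ ≤ M c := hMc
  have := hlev k c h1 htk h2
  rw [hmc] at this
  exact_mod_cast this

/-- Depth form of the previous theorem (bsd-jet's `JET.Section6.depth_le_mdiv_of_perLevel` with `t < k`).
[cite: Jetchev2008, Thm. 1.4 (p. 812)] -/
theorem depth_le_mdiv_of_perLevel_lt
    {Λ : Type*} (M mdiv m : Λ → ℕ∞) (hm : ∀ c, mdiv c < M c → m c ≤ mdiv c)
    (t mInf : ℕ) (hmInf : ∀ c, (mInf : ℕ∞) ≤ m c)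
    (hK : ∀ m' : ℕ, ∃ c, (m' : ℕ∞) ≤ M c ∧ m c = mInf)
    (hlev : ∀ (k : ℕ) (c : Λ), m c < (k : ℕ∞) → t < k → (k : ℕ∞) + m c ≤ M c → (t : ℕ∞) ≤ m c)
    (s : ℕ) (hs : s ≤ t) (c : Λ) (hsc : (s : ℕ∞) ≤ M c) :
    (s : ℕ∞) ≤ mdiv c :=
  Section6.depth_le_mdiv_of_le_mInfty M mdiv m hm mInf hmInf
    (tamagawaExponent_le_mInfty_of_perLevel_lt M m t mInf hK hlev) s hs c hsc

section Generic

universe u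

variable {N : ℕ} [NeZero N] {W : WeierstrassCurve ℚ} {K : Type u} [Field K] [NumberField K]
  {Dt : ModularParametrizationData W N} {β : ℤ} {ι : K →+* ℂ} [W.IsGloballyMinimal]

/-- corner-p1 / tam3-p1's `Koly.pDiv_of_perLevel` with `t < k` in the per-level inequality. [cite: McCallumLMS1991, §5 Prop. 5.2 (p. 304)]
[cite: Jetchev2008, Thm. 1.4 (p. 812)] -/
theorem pDiv_of_perLevel_lt (p t mInf : ℕ)
    (m : ∀ n : ℕ, KolyvaginHeegnerData Dt β ι n → ℕ∞)
    (hm : ∀ (n : ℕ) (d : KolyvaginHeegnerData Dt β ι n), Squarefree n →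
      (∀ ℓ ∈ n.primeFactors, Zhang2014.IsKolyvaginPrime N W K p ℓ) →
      Koly.divOrd d p < Zhang2014.levelIndex W p n → m n d ≤ Koly.divOrd d p)
    (hmInf : ∀ (n : ℕ) (d : KolyvaginHeegnerData Dt β ι n), Squarefree n →
      (∀ ℓ ∈ n.primeFactors, Zhang2014.IsKolyvaginPrime N W K p ℓ) → (mInf : ℕ∞) ≤ m n d)
    (hK : ∀ m' : ℕ, ∃ (n : ℕ) (d : KolyvaginHeegnerData Dt β ι n), Squarefree n ∧
      (∀ ℓ ∈ n.primeFactors, Zhang2014.IsKolyvaginPrime N W K p ℓ) ∧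
      (m' : ℕ∞) ≤ Zhang2014.levelIndex W p n ∧ m n d = mInf)
    (hlev : ∀ (k : ℕ) (n : ℕ) (d : KolyvaginHeegnerData Dt β ι n), Squarefree n →
      (∀ ℓ ∈ n.primeFactors, Zhang2014.IsKolyvaginPrime N W K p ℓ) →
      m n d < (k : ℕ∞) → t < k → (k : ℕ∞) + m n d ≤ Zhang2014.levelIndex W p n →
      (t : ℕ∞) ≤ m n d)
    (s : ℕ) (hs : s ≤ t) (n : ℕ) (d : KolyvaginHeegnerData Dt β ι n) (hn : Squarefree n)
    (hℓ : ∀ ℓ ∈ n.primeFactors,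
      Zhang2014.IsKolyvaginPrime N W K p ℓ ∧ s ≤ Zhang2014.kolyvaginIndex W p ℓ) :
    Koly.PDiv d p s := by
  let Λ : Type u := {c : Σ n : ℕ, KolyvaginHeegnerData Dt β ι n //
    Squarefree c.1 ∧ ∀ ℓ ∈ c.1.primeFactors, Zhang2014.IsKolyvaginPrime N W K p ℓ}
  have hkol : ∀ ℓ ∈ n.primeFactors, Zhang2014.IsKolyvaginPrime N W K p ℓ := fun ℓ h => (hℓ ℓ h).1
  let c₀ : Λ := ⟨⟨n, d⟩, hn, hkol⟩
  have key := depth_le_mdiv_of_perLevel_lt (Λ := Λ)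
    (fun c => Zhang2014.levelIndex W p c.1.1) (fun c => Koly.divOrd c.1.2 p) (fun c => m c.1.1 c.1.2)
    (fun c h => hm c.1.1 c.1.2 c.2.1 c.2.2 h) t mInf (fun c => hmInf c.1.1 c.1.2 c.2.1 c.2.2)
    (fun m' => by
      obtain ⟨n', d', hn', hℓ', hM', hm'⟩ := hK m'
      exact ⟨⟨⟨n', d'⟩, hn', hℓ'⟩, hM', hm'⟩)
    (fun k c h1 h2 h3 => hlev k c.1.1 c.1.2 c.2.1 c.2.2 h1 h2 h3)
    s hs c₀ (Koly.natCast_le_levelIndex_of_forall fun ℓ h => (hℓ ℓ h).2)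
  exact Koly.pDiv_of_le_divOrd d p s key

/-- corner-p1's `Koly.pDiv_of_swap_of_perLevel` (`p^s ∣ P_n` from the swap supply and the per-level inequality ALONE,
frame-generic) with `t < k` in `hlev`: if some admissible `(n, d)` has `ord_p(P_n) < M(n)`, this is
`Koly.kolyvaginRedefinition_of_swap` + `pDiv_of_perLevel_lt`; otherwise every admissible derived point is
`p^{M(n)}`-divisible and `s ≤ M(n)` is immediate. CONDITIONAL on `hswap`, `hlev`; nothing booked.
[cite: McCallumLMS1991, §5 Prop. 5.2 (p. 304)] [cite: Jetchev2008, Thm. 1.4 (p. 812)] -/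
theorem pDiv_of_swap_of_perLevel_lt (p t : ℕ)
    (hswap : ∀ (M e : ℕ) (n : ℕ) (d : KolyvaginHeegnerData Dt β ι n), Squarefree n →
      (∀ ℓ ∈ n.primeFactors, Zhang2014.IsKolyvaginPrime N W K p ℓ ∧ M + 1 ≤ Zhang2014.kolyvaginIndex W p ℓ) →
      (∀ (n' : ℕ) (d' : KolyvaginHeegnerData Dt β ι n'), Squarefree n' →
        (∀ ℓ ∈ n'.primeFactors, Zhang2014.IsKolyvaginPrime N W K p ℓ ∧ M + 1 ≤ Zhang2014.kolyvaginIndex W p ℓ) →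
        Koly.PDiv d' p M) →
      ¬ Koly.PDiv d p (M + 1) →
      ∃ (n' : ℕ) (d' : KolyvaginHeegnerData Dt β ι n'), Squarefree n' ∧
        (∀ ℓ ∈ n'.primeFactors, Zhang2014.IsKolyvaginPrime N W K p ℓ ∧ e ≤ Zhang2014.kolyvaginIndex W p ℓ) ∧
        ¬ Koly.PDiv d' p (M + 1))
    (hlev : ∀ (k n : ℕ) (d : KolyvaginHeegnerData Dt β ι n), Squarefree n →
      (∀ ℓ ∈ n.primeFactors, Zhang2014.IsKolyvaginPrime N W K p ℓ) →
      (if Koly.divOrd d p < Zhang2014.levelIndex W p n then Koly.divOrd d p else (⊤ : ℕ∞)) < (k : ℕ∞) → t < k →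
      (k : ℕ∞) + (if Koly.divOrd d p < Zhang2014.levelIndex W p n then Koly.divOrd d p else ⊤) ≤
        Zhang2014.levelIndex W p n →
      (t : ℕ∞) ≤ (if Koly.divOrd d p < Zhang2014.levelIndex W p n then Koly.divOrd d p else ⊤))
    (s : ℕ) (hs : s ≤ t) (n : ℕ) (d : KolyvaginHeegnerData Dt β ι n) (hn : Squarefree n)
    (hℓ : ∀ ℓ ∈ n.primeFactors, Zhang2014.IsKolyvaginPrime N W K p ℓ ∧ s ≤ Zhang2014.kolyvaginIndex W p ℓ) :
    Koly.PDiv d p s := by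
  by_cases hfin : ∃ (n' : ℕ) (d' : KolyvaginHeegnerData Dt β ι n'), Squarefree n' ∧
      (∀ ℓ ∈ n'.primeFactors, Zhang2014.IsKolyvaginPrime N W K p ℓ) ∧
      Koly.divOrd d' p < Zhang2014.levelIndex W p n'
  · obtain ⟨mInf, hmInf, hK⟩ := Koly.kolyvaginRedefinition_of_swap p hfin hswap
    exact pDiv_of_perLevel_lt p t mInf
      (fun n d => if Koly.divOrd d p < Zhang2014.levelIndex W p n then Koly.divOrd d p else ⊤)
      (fun n d _ _ h => by simp [h]) hmInf hK hlev s hs n d hn hℓ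
  · push Not at hfin
    apply Koly.pDiv_of_le_divOrd d p s
    calc (s : ℕ∞) ≤ Zhang2014.levelIndex W p n := Koly.natCast_le_levelIndex_of_forall fun ℓ h => (hℓ ℓ h).2
      _ ≤ Koly.divOrd d p := hfin n d hn fun ℓ h => (hℓ ℓ h).1

end Generic

end Summit.BirchSwinnertonDyer.Rank1Residual.JET.Split

end
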